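import Summits.BirchSwinnertonDyer.BirchSwinnertonDyer.Theses.SignedLowerHalves
import Literature.NumberTheory.EllipticCurves.Sprung2012.SharpFlatKatoDivisibility
import Literature.NumberTheory.EllipticCurves.Sprung2012.ColemanMapTheorems
import Literature.NumberTheory.EllipticCurves.ModularParametrizationBCDTProofs
import HarnessLib

/-!
# Route `SignedLowerHalves`, crux 5 `SprungLowerHalfAtThree` — the KDOT split's fourth child
# `SharpFlatPublishedInputsAtThree` (item stmt-BirchSwinnertonDyer-19929, rev 14) FROM ITS NAMED
# PRINT SOURCES: the one-line edges `exists_isNewformOf → thm22 → thm714 → S4`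
# (cell `bsd-ssimc`, seat `bsd-ssimc-k3c5-kdot-split` g4; `--supports … --as helper`, closes nothing)

PARTITION (cell bsd-ssimc): X8 (A8) — `p = 3` good supersingular, `a_3 = ±3` — all conductors;
proves-the-edges-of (faithfulness of the restated support child to its three published inputs);
closes NONE (the child stays a HELD input: the three Literature facts are named, not proved); 0 census
moves; BSD is not proved by any of this.

## What this file proves

Rev 14 of the route restated the support child S4 of the crux-5 split as the published inputs
RESTRICTED TO X8 and SPELLED OUT (so that no `cite_only` Literature constant sits un-aliased in the
route's cone). This file records, in the kernel, that the restated child is implied by the named print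
facts it paraphrases — the planner's «one-line edges for a prover» (route file, item 19929 docstring):

* `sharpFlatPublishedInputsAtThree_of_namedFacts :
    exists_isNewformOf → Sprung2012.thm22_exists_isHondaSystem →
    Sprung2012.thm714_sharpFlatSelmerDual_finite_torsion → SharpFlatPublishedInputsAtThree`
  — (M) from the Modularity Theorem's existence half (`exists_isNewformOf`, BCDT 2001 Thm. A, level
  `N_W ≥ 1` by `conductorNorm_pos_holds`); (H) = Sprung 2012 Thm. 2.2 at `p = 3`; (T) = Sprung 2012
  Thm. 1.2 / 7.14 at `p = 3` (binders re-ordered, nothing else);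
* `sharpFlatPublishedInputsAtThree_of_modularParametrizationSupply` — the same with modularity
  spelled as the route's HELD support `ModularParametrizationSupply` (item stmt-BirchSwinnertonDyer-19266
  = `nonempty_modularParametrizationData`), via the tree edge
  `exists_isNewformOf_of_nonempty_modularParametrizationData`;
* `sharpFlatPublishedInputsAtThree_of_publishedSignedInputs` — the same from the deciding theorem's
  binder `PublishedSignedInputs` (its eighth conjunct).

HONEST STATUS: CONDITIONAL on the displayed named facts (published, refereed: BCDT 2001; Sprung, J.
Number Theory 132 (2012) Thm. 2.2 and Thm. 1.2/7.14 — the latter via Kato's Euler system, any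
conductor); closes nothing; 0 cells move. Together with the glue
(`SignedLowerHalvesSprungLowerHalfAtThreeSplit.lean`) crux 5 reads BY NAME
`K1 ∧ K2 ∧ lem59AllN ∧ thm22 ∧ thm714 ∧ exists_isNewformOf ⟹ SprungLowerHalfAtThree`.

References: [Sprung2012] Thm. 2.2 (p. 1487), Thm. 1.2 (p. 1486) = Thm. 7.14 (p. 1504);
[BCDTJAMS2001] Thm. A; [DiamondShurman2005] Thm. 8.8.3.
-/

set_option autoImplicit false
-- justification: the mandated namespace `Summit.BirchSwinnertonDyer.BirchSwinnertonDyer.Theorems`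
-- (single-conjunct summit, Sub = Summit) repeats a segment by design (D-0017).
set_option linter.dupNamespace false

noncomputable section

namespace Summit.BirchSwinnertonDyer.BirchSwinnertonDyer.Theorems.SprungLowerHalfAtThreeSplit

open scoped Classical NumberField MatrixGroups ModularForm
open NumberField IsDedekindDomain WeierstrassCurve CongruenceSubgroup
  Literature.NumberTheory.EllipticCurves Literature.NumberTheory.EllipticCurves.ModularForms
  Literature.NumberTheory.EllipticCurves.Rank1Residual
  Literature.NumberTheory.EllipticCurves.Sprung2017 Literature.NumberTheory.EllipticCurves.Sprung2012
  Literature.NumberTheory.EllipticCurves.ZpExtension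
  Summit.BirchSwinnertonDyer.BirchSwinnertonDyer.Theses.SignedLowerHalves

/-- **S4 `SharpFlatPublishedInputsAtThree` from its three named print sources.** For every X8 pair
`(W, 3)`: (M) a weight-2 newform of `W` — from `exists_isNewformOf` (Modularity, existence half, at
level `N_W`, `N_W ≥ 1` by `conductorNorm_pos_holds`); (H) a Honda system in Sprung's cyclotomic setting
— `Sprung2012.thm22_exists_isHondaSystem` at `p = 3` (`3 ≠ 2`, good reduction and `3 ∣ a_3` from
`ClassX8`); (T) `X^• = D.X` finitely generated torsion over `Λ` whenever `L^• ≠ 0` —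
`Sprung2012.thm714_sharpFlatSelmerDual_finite_torsion` at `p = 3` (binders re-ordered). CONDITIONAL on
the three displayed facts; closes nothing (the child is a HELD input).
[cite: BCDTJAMS2001, Thm. A] [cite: Sprung2012, Thm. 2.2 (p. 1487) and Thm. 1.2 (p. 1486)] -/
theorem sharpFlatPublishedInputsAtThree_of_namedFacts
    (hmod : exists_isNewformOf) (h22 : Sprung2012.thm22_exists_isHondaSystem)
    (h714 : Sprung2012.thm714_sharpFlatSelmerDual_finite_torsion) :
    Summit.BirchSwinnertonDyer.BirchSwinnertonDyer.Theses.SignedLowerHalves.SharpFlatPublishedInputsAtThree := by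
  unfold Summit.BirchSwinnertonDyer.BirchSwinnertonDyer.Theses.SignedLowerHalves.SharpFlatPublishedInputsAtThree
  intro W _ _ p _ hX
  have hp3 : p = 3 := hX.1
  subst hp3
  have hp2 : (3 : ℕ) ≠ 2 := by decide
  have hgood : W.HasGoodReductionAtPrime 3 := hX.2.1.1
  have hdvd : ((3 : ℕ) : ℤ) ∣ W.frobeniusTrace 3 := hX.2.1.2
  refine ⟨?_, ?_⟩
  · -- (M) modularity: the newform of level `N_W`
    haveI hN : NeZero (W.conductorNorm ℤ) := ⟨(W.conductorNorm_pos_holds).ne'⟩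
    obtain ⟨f, hf⟩ := hmod W
    exact ⟨W.conductorNorm ℤ, hN, f, hf⟩
  · -- (H) Sprung 2012 Thm. 2.2 and (T) Thm. 1.2 / 7.14, at `p = 3`
    intro κ γ hκ hγ hγ' v hv g hg
    refine ⟨h22 W 3 hp2 hgood hdvd κ γ hκ hγ hγ' v hv g hg, ?_⟩
    intro cneg c hc N hN f hf col Lsharp Lflat hSP hcol D
    haveI := hN
    exact h714 W 3 hp2 hgood hdvd f hf κ γ hκ hγ hγ' v hv g hg cneg c hc col Lsharp Lflat hSP hcol D

/-- **S4 from the route's HELD modularity support `ModularParametrizationSupply`** (item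
stmt-BirchSwinnertonDyer-19266 = `nonempty_modularParametrizationData`, BCDT 2001 Thm. A as
parametrisation data) and Sprung 2012 Thm. 2.2 / Thm. 1.2: the previous theorem through the tree edge
`exists_isNewformOf_of_nonempty_modularParametrizationData`. CONDITIONAL; closes nothing.
[cite: BCDTJAMS2001, Thm. A] [cite: Sprung2012, Thm. 2.2 (p. 1487) and Thm. 1.2 (p. 1486)] -/
theorem sharpFlatPublishedInputsAtThree_of_modularParametrizationSupply
    (hmodP : Summit.BirchSwinnertonDyer.BirchSwinnertonDyer.Theses.SignedLowerHalves.ModularParametrizationSupply)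
    (h22 : Sprung2012.thm22_exists_isHondaSystem)
    (h714 : Sprung2012.thm714_sharpFlatSelmerDual_finite_torsion) :
    Summit.BirchSwinnertonDyer.BirchSwinnertonDyer.Theses.SignedLowerHalves.SharpFlatPublishedInputsAtThree :=
  sharpFlatPublishedInputsAtThree_of_namedFacts
    (exists_isNewformOf_of_nonempty_modularParametrizationData hmodP) h22 h714

/-- **S4 from the deciding theorem's binder `PublishedSignedInputs`** (item stmt-BirchSwinnertonDyer-19005;
projection to its eighth conjunct `nonempty_modularParametrizationData`, the other nine conjuncts unused)
and Sprung 2012 Thm. 2.2 / Thm. 1.2. CONDITIONAL; closes nothing.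
[cite: BCDTJAMS2001, Thm. A] [cite: Sprung2012, Thm. 2.2 (p. 1487) and Thm. 1.2 (p. 1486)] -/
theorem sharpFlatPublishedInputsAtThree_of_publishedSignedInputs
    (hPub : Summit.BirchSwinnertonDyer.BirchSwinnertonDyer.Theses.SignedLowerHalves.PublishedSignedInputs)
    (h22 : Sprung2012.thm22_exists_isHondaSystem)
    (h714 : Sprung2012.thm714_sharpFlatSelmerDual_finite_torsion) :
    Summit.BirchSwinnertonDyer.BirchSwinnertonDyer.Theses.SignedLowerHalves.SharpFlatPublishedInputsAtThree :=
  sharpFlatPublishedInputsAtThree_of_modularParametrizationSupply hPub.2.2.2.2.2.2.2.1 h22 h714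

end Summit.BirchSwinnertonDyer.BirchSwinnertonDyer.Theorems.SprungLowerHalfAtThreeSplit

end
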